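import Summits.HubbardSuperconductivity.HubbardSuperconductivity.Theorems.PbContinuationEndpointClosure
import Literature.MathematicalPhysics.QuantumLattice.PlaquetteBreathingSelfDuality
import Literature.MathematicalPhysics.QuantumLattice.SiteBijectionSectorTransport
import HarnessLib

/-!
# Crux `PbContinuation` (stmt-HubbardSuperconductivity-0907) — the TWO-TILING RAY: the checkerboard
# Hamiltonian plus its diagonal translate is a uniform Hubbard Hamiltonian, and the Anderson bound
# along the ray

Support file (restatement-invariant algebra) for the continuation crux shared by the routes
`PlaquetteBoson` (`PbContinuation`), `LevyLogBootstrap` / `AnisotropyChord` / `PolyaSchurPairBoson`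
(`Continuation`). The crux walks the checkerboard Hubbard tori
`H_A(t',U) = hamiltonian (G ∖ K) 1 U + hamiltonian (G ⊓ K) t' 0` (`G = fermionTorusGraph 2 L`,
`K` = "different `2 × 2` plaquette", hopping `1` inside the plaquettes, `t'` between them, on-site
`U`) from small `t'` to the uniform point `t' = 1`, `H_A(1,U) = hubbardTorus 2 L 1 U`.

On the `L`-torus with `L` even, `L ≥ 4`, the diagonal translation `x ↦ x + (1,1)` maps the plaquette
tiling onto the complementary tiling and therefore swaps intra- and inter-plaquette bonds (tree:
`Literature.MathematicalPhysics.QuantumLattice.relabel_translate_breathing`). Consequently the SUM of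
the checkerboard Hamiltonian and its translate has hopping `1 + t'` on EVERY bond and interaction
`2U` on every site:

* `twoTiling_sum` — `H_A(t',U) + T₍₁,₁₎ H_A(t',U) T₍₁,₁₎⁻¹ = hamiltonian G (1+t') (2U)`;
* `twoTiling_partner` — `hamiltonian G (1+t') (2U) = (1+t') • hubbardTorus 2 L 1 (2U/(1+t'))`
  (`1 + t' ≠ 0`): along `t' ∈ (0,1]` the uniform PARTNER of the checkerboard point `(t',U)` runs over
  the ray of couplings `2U/(1+t') ∈ [U, 2U)`;
* `two_mul_sectorEnergy_le_partner` — the ANDERSON BOUND in every sector `(2n, S^z = 0)`: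
  `2 · E_{(2n,0)}(H_A(t',U)) ≤ E_{(2n,0)}(hamiltonian G (1+t') (2U))` (the translate has the same
  sector energies, `minEnergyOn_relabel_szSector`, and a sum is bounded below by the sum of the
  bounds);
* `expect_checkerboard_sub_le_frustration` — every normalised sector ground state `ψ` of the partner
  is a LOW-ENERGY state of the checkerboard Hamiltonian up to the frustration energy:
  `re⟨ψ, H_A ψ⟩ − E(H_A) ≤ E(partner) − 2·E(H_A)` (and this frustration is `≥ 0`).

These are the "first lemma" and the "next checkable statement" of the crux idea `two-tiling-ray`
(`Cruxes/PbContinuation/Ideas/two-tiling-ray.md`, ideator k1, whose `SketchR1K1.lean` proved the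
identity in a crux workfile; re-proved here so that it is importable from `Theorems/`), the algebra
behind the strategist's recommended restatement R5 `ContinuationRay`
(`Cruxes/PbContinuation/STRATEGY-CENSUS.md` §5). Nothing here bears on the truth of the crux as
typed; in particular the abstract "sum shape" (both summands every-GS ordered ⇒ the sum ordered) is
false (TERMINUS-r1-k1 §5 B6), so the ray is an exact energy handle and a re-aiming device, not an
order-transfer principle. Folklore (P. W. Anderson, Phys. Rev. 83 (1951) 1260: the ground energy of
a sum of Hamiltonians is at least the sum of their ground energies). No definition is introduced.
-/

noncomputable section

namespace Summit.HubbardSuperconductivity.PbContinuation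

open Matrix
open Literature.MathematicalPhysics.QuantumLattice Literature.Probability.LatticeModels

/-! ### Joint linearity and scaling of the Hubbard Hamiltonian in `(t, U)` -/

section Algebra

variable {Λ : Type*} [LinearOrder Λ] [Fintype Λ] (X : SimpleGraph Λ) [DecidableRel X.Adj]

/-- Joint additivity of the Hubbard Hamiltonian of a fixed graph in `(t,U)`:
`H_X(a,U) + H_X(b,V) = H_X(a+b, U+V)`. [folklore] -/
theorem hamiltonian_add_hamiltonian_same (a b U V : ℝ) :
    hamiltonian X a U + hamiltonian X b V = hamiltonian X (a + b) (U + V) := by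
  unfold hamiltonian
  push_cast
  simp only [neg_add, add_smul]
  abel

/-- Joint homogeneity: `H_X(c·t, c·U) = c • H_X(t,U)`. [folklore] -/
theorem hamiltonian_scale (c t U : ℝ) :
    hamiltonian X (c * t) (c * U) = (c : ℂ) • hamiltonian X t U := by
  unfold hamiltonian
  push_cast
  rw [smul_add, smul_smul, smul_smul, mul_neg]

end Algebra

/-! ### The two-tiling identity on the torus -/

section Torus

variable {L : ℕ} [NeZero L]

/-- **Two-tiling sum identity** (even `L ≥ 4`). The checkerboard Hubbard Hamiltonian with
intra-plaquette hopping `1`, inter-plaquette hopping `t'` and on-site `U`, plus its conjugate by the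
diagonal translation unitary `T₍₁,₁₎` (which carries it to the complementary tiling,
`relabel_translate_breathing`), is the UNIFORM Hubbard Hamiltonian with hopping `1 + t'` and
interaction `2U` (the two tilings partition the bonds — `CooperPairDMottWalk.hamiltonian_sdiff_add_inf`
— and the on-site term is counted twice). [folklore] -/
theorem twoTiling_sum (hL : Even L) (h4 : 4 ≤ L) (t' U : ℝ) :
    (hamiltonian (fermionTorusGraph 2 L \ (⊤ : SimpleGraph (Fin 2 → ℕ)).comap
          (fun (x : FermionTorus 2 L) (i : Fin 2) => (ofLex x i : ℕ) / 2)) 1 U +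
        hamiltonian (fermionTorusGraph 2 L ⊓ (⊤ : SimpleGraph (Fin 2 → ℕ)).comap
          (fun (x : FermionTorus 2 L) (i : Fin 2) => (ofLex x i : ℕ) / 2)) t' 0) +
      relabel (Orb.translate (fun _ : Fin 2 => (1 : ZMod L)))
        (hamiltonian (fermionTorusGraph 2 L \ (⊤ : SimpleGraph (Fin 2 → ℕ)).comap
            (fun (x : FermionTorus 2 L) (i : Fin 2) => (ofLex x i : ℕ) / 2)) 1 U +
          hamiltonian (fermionTorusGraph 2 L ⊓ (⊤ : SimpleGraph (Fin 2 → ℕ)).comap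
            (fun (x : FermionTorus 2 L) (i : Fin 2) => (ofLex x i : ℕ) / 2)) t' 0) =
      hamiltonian (fermionTorusGraph 2 L) (1 + t') (2 * U) := by
  rw [relabel_translate_breathing hL h4 1 t' U]
  have key : ∀ (A B C D : Matrix (Finset (Orb (FermionTorus 2 L))) (Finset (Orb (FermionTorus 2 L))) ℂ),
      (A + B) + (C + D) = (A + C) + (B + D) := fun A B C D => by abel
  rw [key, hamiltonian_add_hamiltonian_same, hamiltonian_add_hamiltonian_same,
    show U + U = 2 * U by ring, show t' + (1 : ℝ) = 1 + t' by ring, show (0 : ℝ) + 0 = 0 by ring]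
  exact Summit.HubbardSuperconductivity.HubbardSuperconductivity.Theorems.CooperPairDMottWalk.hamiltonian_sdiff_add_inf
    _ _ (1 + t') (2 * U)

omit [NeZero L] in
/-- **The partner coupling on the ray**: for `1 + t' ≠ 0`,
`hamiltonian G (1+t') (2U) = (1+t') • hubbardTorus 2 L 1 (2U/(1+t'))`; along `t' ∈ (0,1]` the
partner coupling `2U/(1+t')` runs over `[U, 2U)`. [folklore] -/
theorem twoTiling_partner (t' U : ℝ) (ht : 1 + t' ≠ 0) :
    hamiltonian (fermionTorusGraph 2 L) (1 + t') (2 * U) =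
      ((1 + t' : ℝ) : ℂ) • hubbardTorus 2 L 1 (2 * U / (1 + t')) := by
  rw [hubbardTorus, ← hamiltonian_scale]
  congr 1 <;> field_simp

omit [NeZero L] in
/-- At the uniform point the partner is twice the uniform Hamiltonian:
`hamiltonian G (1+1) (2U) = 2 • hubbardTorus 2 L 1 U`. [folklore] -/
theorem twoTiling_partner_one (U : ℝ) :
    hamiltonian (fermionTorusGraph 2 L) (1 + 1) (2 * U) = (2 : ℂ) • hubbardTorus 2 L 1 U := by
  rw [hubbardTorus, show ((2 : ℂ)) = ((2 : ℝ) : ℂ) by norm_num, ← hamiltonian_scale, mul_one,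
    one_add_one_eq_two]

/-! ### The Anderson bound along the ray -/

/-- Lower bounds pass to the sector energy: if `K` contains a unit vector and `b ≤ re⟨ψ, A ψ⟩` for
every unit `ψ ∈ K`, then `b ≤ minEnergyOn A K` (Tasaki (2020) §2.1). [folklore] -/
theorem le_minEnergyOn_of_forall_unit' {n : Type*} [Fintype n] (A : Matrix n n ℂ)
    (K : Submodule ℂ (n → ℂ)) {b : ℝ} (hne : ∃ ψ ∈ K, star ψ ⬝ᵥ ψ = 1)
    (h : ∀ ψ ∈ K, star ψ ⬝ᵥ ψ = 1 → b ≤ (star ψ ⬝ᵥ A *ᵥ ψ).re) : b ≤ A.minEnergyOn K := by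
  obtain ⟨ψ₀, hψ₀K, hψ₀⟩ := hne
  refine le_csInf ⟨_, ψ₀, hψ₀K, hψ₀, rfl⟩ ?_
  rintro E ⟨ψ, hψK, hψ, rfl⟩
  exact h ψ hψK hψ

/-- **The translate has the same sector Rayleigh bound.** For every unit vector `φ` of the
`(2n, S^z = 0)` sector, `re⟨φ, (T H_A T⁻¹) φ⟩ ≥ E_{(2n,0)}(H_A)`: pull `φ` back along the
translation unitary (`relabelVecInv`), which preserves the sector, the norm and the expectation.
[folklore] -/
theorem sectorEnergy_le_re_expect_translate (v : TorusSite 2 L) (t' U : ℝ) {n : ℕ}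
    (hn : n ≤ Fintype.card (FermionTorus 2 L)) (φ : Fock (Orb (FermionTorus 2 L)))
    (hφ : φ ∈ szSector (Λ := FermionTorus 2 L) (2 * n) (0 : ℝ)) (hφ1 : star φ ⬝ᵥ φ = 1) :
    (hamiltonian (fermionTorusGraph 2 L \ (⊤ : SimpleGraph (Fin 2 → ℕ)).comap
          (fun (x : FermionTorus 2 L) (i : Fin 2) => (ofLex x i : ℕ) / 2)) 1 U +
        hamiltonian (fermionTorusGraph 2 L ⊓ (⊤ : SimpleGraph (Fin 2 → ℕ)).comap
          (fun (x : FermionTorus 2 L) (i : Fin 2) => (ofLex x i : ℕ) / 2)) t' 0).minEnergyOn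
        (szSector (2 * n) 0) ≤
      (expect (relabel (Orb.translate v)
        (hamiltonian (fermionTorusGraph 2 L \ (⊤ : SimpleGraph (Fin 2 → ℕ)).comap
            (fun (x : FermionTorus 2 L) (i : Fin 2) => (ofLex x i : ℕ) / 2)) 1 U +
          hamiltonian (fermionTorusGraph 2 L ⊓ (⊤ : SimpleGraph (Fin 2 → ℕ)).comap
            (fun (x : FermionTorus 2 L) (i : Fin 2) => (ofLex x i : ℕ) / 2)) t' 0)) φ).re := by
  set T : Equiv.Perm (Orb (FermionTorus 2 L)) := Orb.translate v with hT
  set φ' : Fock (Orb (FermionTorus 2 L)) := relabelVecInv T φ with hφ'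
  have hback : relabelVec T φ' = φ := relabelVec_relabelVecInv T φ
  -- the pulled-back vector lies in the same sector and is normalised
  have hφ'mem : φ' ∈ szSector (Λ := FermionTorus 2 L) (2 * n) (0 : ℝ) := by
    apply mem_szSector_of_relabelVec_mem (FermionTorus.ofTorusEquiv (Equiv.addRight v))
    rw [show Orb.mapEquiv (FermionTorus.ofTorusEquiv (Equiv.addRight v)) = T from rfl, hback]
    exact hφ
  have hφ'1 : star φ' ⬝ᵥ φ' = 1 := by
    rw [← star_relabelVec_dotProduct T, hback, hφ1]
  -- expectation is invariant, then the variational bound for `φ'`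
  rw [← hback, expect_relabel_relabelVec]
  have hvar := (twoHopping_sector_groundState
    (fermionTorusGraph 2 L \ (⊤ : SimpleGraph (Fin 2 → ℕ)).comap
      (fun (x : FermionTorus 2 L) (i : Fin 2) => (ofLex x i : ℕ) / 2))
    (fermionTorusGraph 2 L ⊓ (⊤ : SimpleGraph (Fin 2 → ℕ)).comap
      (fun (x : FermionTorus 2 L) (i : Fin 2) => (ofLex x i : ℕ) / 2)) 1 U t' hn).2 φ' hφ'mem
  rwa [hφ'1, Complex.one_re, mul_one] at hvar

/-- **Anderson bound along the two-tiling ray** (even `L ≥ 4`, sector `(2n, S^z = 0)`, `n ≤ L²`):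
twice the sector energy of the checkerboard Hamiltonian `H_A(t',U)` is at most the sector energy of
its uniform partner `hamiltonian G (1+t') (2U) = H_A + T H_A T⁻¹` — the ground energy of a sum is at
least the sum of the ground energies, and the translate is isospectral in the sector.
P. W. Anderson, Phys. Rev. 83 (1951) 1260. [folklore] -/
theorem two_mul_sectorEnergy_le_partner (hL : Even L) (h4 : 4 ≤ L) (t' U : ℝ) {n : ℕ}
    (hn : n ≤ Fintype.card (FermionTorus 2 L)) :
    2 * (hamiltonian (fermionTorusGraph 2 L \ (⊤ : SimpleGraph (Fin 2 → ℕ)).comap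
          (fun (x : FermionTorus 2 L) (i : Fin 2) => (ofLex x i : ℕ) / 2)) 1 U +
        hamiltonian (fermionTorusGraph 2 L ⊓ (⊤ : SimpleGraph (Fin 2 → ℕ)).comap
          (fun (x : FermionTorus 2 L) (i : Fin 2) => (ofLex x i : ℕ) / 2)) t' 0).minEnergyOn
        (szSector (2 * n) 0) ≤
      (hamiltonian (fermionTorusGraph 2 L) (1 + t') (2 * U)).minEnergyOn (szSector (2 * n) 0) := by
  rw [← twoTiling_sum hL h4 t' U]
  -- a unit vector of the sector exists (a normalised sector ground state of `H_A`)
  obtain ⟨ψ₀, hψ₀1, hψ₀⟩ := exists_unit_groundState_twoHopping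
    (fermionTorusGraph 2 L \ (⊤ : SimpleGraph (Fin 2 → ℕ)).comap
      (fun (x : FermionTorus 2 L) (i : Fin 2) => (ofLex x i : ℕ) / 2))
    (fermionTorusGraph 2 L ⊓ (⊤ : SimpleGraph (Fin 2 → ℕ)).comap
      (fun (x : FermionTorus 2 L) (i : Fin 2) => (ofLex x i : ℕ) / 2)) 1 U t' hn
  refine le_minEnergyOn_of_forall_unit' _ _ ⟨ψ₀, hψ₀.1, hψ₀1⟩ fun φ hφ hφ1 => ?_
  -- split the expectation of the sum
  have hsplit : (star φ ⬝ᵥ ((hamiltonian (fermionTorusGraph 2 L \ (⊤ : SimpleGraph (Fin 2 → ℕ)).comap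
          (fun (x : FermionTorus 2 L) (i : Fin 2) => (ofLex x i : ℕ) / 2)) 1 U +
        hamiltonian (fermionTorusGraph 2 L ⊓ (⊤ : SimpleGraph (Fin 2 → ℕ)).comap
          (fun (x : FermionTorus 2 L) (i : Fin 2) => (ofLex x i : ℕ) / 2)) t' 0) +
      relabel (Orb.translate (fun _ : Fin 2 => (1 : ZMod L)))
        (hamiltonian (fermionTorusGraph 2 L \ (⊤ : SimpleGraph (Fin 2 → ℕ)).comap
            (fun (x : FermionTorus 2 L) (i : Fin 2) => (ofLex x i : ℕ) / 2)) 1 U +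
          hamiltonian (fermionTorusGraph 2 L ⊓ (⊤ : SimpleGraph (Fin 2 → ℕ)).comap
            (fun (x : FermionTorus 2 L) (i : Fin 2) => (ofLex x i : ℕ) / 2)) t' 0)) *ᵥ φ).re =
      (expect (hamiltonian (fermionTorusGraph 2 L \ (⊤ : SimpleGraph (Fin 2 → ℕ)).comap
          (fun (x : FermionTorus 2 L) (i : Fin 2) => (ofLex x i : ℕ) / 2)) 1 U +
        hamiltonian (fermionTorusGraph 2 L ⊓ (⊤ : SimpleGraph (Fin 2 → ℕ)).comap
          (fun (x : FermionTorus 2 L) (i : Fin 2) => (ofLex x i : ℕ) / 2)) t' 0) φ).re +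
      (expect (relabel (Orb.translate (fun _ : Fin 2 => (1 : ZMod L)))
        (hamiltonian (fermionTorusGraph 2 L \ (⊤ : SimpleGraph (Fin 2 → ℕ)).comap
            (fun (x : FermionTorus 2 L) (i : Fin 2) => (ofLex x i : ℕ) / 2)) 1 U +
          hamiltonian (fermionTorusGraph 2 L ⊓ (⊤ : SimpleGraph (Fin 2 → ℕ)).comap
            (fun (x : FermionTorus 2 L) (i : Fin 2) => (ofLex x i : ℕ) / 2)) t' 0)) φ).re := by
    rw [← Complex.add_re, ← expect_add]
    rfl
  rw [hsplit, two_mul]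
  refine add_le_add ?_ (sectorEnergy_le_re_expect_translate _ t' U hn φ hφ hφ1)
  have hvar := (twoHopping_sector_groundState
    (fermionTorusGraph 2 L \ (⊤ : SimpleGraph (Fin 2 → ℕ)).comap
      (fun (x : FermionTorus 2 L) (i : Fin 2) => (ofLex x i : ℕ) / 2))
    (fermionTorusGraph 2 L ⊓ (⊤ : SimpleGraph (Fin 2 → ℕ)).comap
      (fun (x : FermionTorus 2 L) (i : Fin 2) => (ofLex x i : ℕ) / 2)) 1 U t' hn).2 φ hφ
  rwa [hφ1, Complex.one_re, mul_one] at hvar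

/-- **Every sector ground state of the uniform partner is a low-energy state of the checkerboard
Hamiltonian, up to the frustration energy.** For a normalised `(2n, S^z=0)`-sector ground state `ψ`
of `hamiltonian G (1+t') (2U)` (even `L ≥ 4`):
`re⟨ψ, H_A(t',U) ψ⟩ − E(H_A) ≤ E(partner) − 2·E(H_A)`, where `E(·)` is the sector energy; by
`two_mul_sectorEnergy_le_partner` the right-hand side (the frustration of the two tilings) is
non-negative. [folklore] -/
theorem expect_checkerboard_sub_le_frustration (hL : Even L) (h4 : 4 ≤ L) (t' U : ℝ) {n : ℕ}
    (hn : n ≤ Fintype.card (FermionTorus 2 L)) {ψ : Fock (Orb (FermionTorus 2 L))}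
    (hψ1 : star ψ ⬝ᵥ ψ = 1)
    (hψ : IsGroundStateInSector (hamiltonian (fermionTorusGraph 2 L) (1 + t') (2 * U)) (2 * n) 0 ψ) :
    (expect (hamiltonian (fermionTorusGraph 2 L \ (⊤ : SimpleGraph (Fin 2 → ℕ)).comap
          (fun (x : FermionTorus 2 L) (i : Fin 2) => (ofLex x i : ℕ) / 2)) 1 U +
        hamiltonian (fermionTorusGraph 2 L ⊓ (⊤ : SimpleGraph (Fin 2 → ℕ)).comap
          (fun (x : FermionTorus 2 L) (i : Fin 2) => (ofLex x i : ℕ) / 2)) t' 0) ψ).re -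
      (hamiltonian (fermionTorusGraph 2 L \ (⊤ : SimpleGraph (Fin 2 → ℕ)).comap
          (fun (x : FermionTorus 2 L) (i : Fin 2) => (ofLex x i : ℕ) / 2)) 1 U +
        hamiltonian (fermionTorusGraph 2 L ⊓ (⊤ : SimpleGraph (Fin 2 → ℕ)).comap
          (fun (x : FermionTorus 2 L) (i : Fin 2) => (ofLex x i : ℕ) / 2)) t' 0).minEnergyOn
        (szSector (2 * n) 0) ≤
      (hamiltonian (fermionTorusGraph 2 L) (1 + t') (2 * U)).minEnergyOn (szSector (2 * n) 0) -
        2 * (hamiltonian (fermionTorusGraph 2 L \ (⊤ : SimpleGraph (Fin 2 → ℕ)).comap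
          (fun (x : FermionTorus 2 L) (i : Fin 2) => (ofLex x i : ℕ) / 2)) 1 U +
        hamiltonian (fermionTorusGraph 2 L ⊓ (⊤ : SimpleGraph (Fin 2 → ℕ)).comap
          (fun (x : FermionTorus 2 L) (i : Fin 2) => (ofLex x i : ℕ) / 2)) t' 0).minEnergyOn
        (szSector (2 * n) 0) := by
  -- the partner's energy in `ψ` is its sector energy, and splits as `⟨H_A⟩ + ⟨T H_A T⁻¹⟩`
  have hE : (expect (hamiltonian (fermionTorusGraph 2 L) (1 + t') (2 * U)) ψ).re =
      (hamiltonian (fermionTorusGraph 2 L) (1 + t') (2 * U)).minEnergyOn (szSector (2 * n) 0) := by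
    rw [expect_eq_sectorEnergy hψ1 hψ, Complex.ofReal_re]
  have hsum := congrArg (fun A => (expect A ψ).re) (twoTiling_sum hL h4 t' U)
  simp only [expect_add, Complex.add_re] at hsum
  have htr := sectorEnergy_le_re_expect_translate (fun _ : Fin 2 => (1 : ZMod L)) t' U hn ψ hψ.1 hψ1
  rw [expect_add, Complex.add_re]
  linarith

end Torus

/-! ### Closed forms (registered support sub-goals of stmt-HubbardSuperconductivity-0907) -/

/-- **Two-tiling sum identity, closed form** (registered support sub-goal `twoTilingSum`): for even
`L ≥ 4` and all `t', U`, the checkerboard Hamiltonian plus its diagonal translate is the uniform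
Hubbard Hamiltonian with hopping `1 + t'` and interaction `2U`. [folklore] -/
theorem twoTilingSum :
    ∀ (L : ℕ) [NeZero L], Even L → 4 ≤ L → ∀ (t' U : ℝ),
      (hamiltonian (fermionTorusGraph 2 L \ (⊤ : SimpleGraph (Fin 2 → ℕ)).comap
          (fun (x : FermionTorus 2 L) (i : Fin 2) => (ofLex x i : ℕ) / 2)) 1 U +
        hamiltonian (fermionTorusGraph 2 L ⊓ (⊤ : SimpleGraph (Fin 2 → ℕ)).comap
          (fun (x : FermionTorus 2 L) (i : Fin 2) => (ofLex x i : ℕ) / 2)) t' 0) +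
      relabel (Orb.translate (fun _ : Fin 2 => (1 : ZMod L)))
        (hamiltonian (fermionTorusGraph 2 L \ (⊤ : SimpleGraph (Fin 2 → ℕ)).comap
            (fun (x : FermionTorus 2 L) (i : Fin 2) => (ofLex x i : ℕ) / 2)) 1 U +
          hamiltonian (fermionTorusGraph 2 L ⊓ (⊤ : SimpleGraph (Fin 2 → ℕ)).comap
            (fun (x : FermionTorus 2 L) (i : Fin 2) => (ofLex x i : ℕ) / 2)) t' 0) =
      hamiltonian (fermionTorusGraph 2 L) (1 + t') (2 * U) :=
  fun _ _ hL h4 t' U => twoTiling_sum hL h4 t' U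

/-- **Anderson bound along the two-tiling ray, closed form** (registered support sub-goal
`rayAndersonBound`): for even `L ≥ 4`, all `t', U` and every sector `(2n, S^z = 0)` with `n ≤ L²`,
`2 · E_{(2n,0)}(H_A(t',U)) ≤ E_{(2n,0)}(hamiltonian G (1+t') (2U))`.
P. W. Anderson, Phys. Rev. 83 (1951) 1260. [folklore] -/
theorem rayAndersonBound :
    ∀ (L : ℕ) [NeZero L], Even L → 4 ≤ L → ∀ (t' U : ℝ) (n : ℕ), n ≤ L ^ 2 →
      2 * (hamiltonian (fermionTorusGraph 2 L \ (⊤ : SimpleGraph (Fin 2 → ℕ)).comap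
          (fun (x : FermionTorus 2 L) (i : Fin 2) => (ofLex x i : ℕ) / 2)) 1 U +
        hamiltonian (fermionTorusGraph 2 L ⊓ (⊤ : SimpleGraph (Fin 2 → ℕ)).comap
          (fun (x : FermionTorus 2 L) (i : Fin 2) => (ofLex x i : ℕ) / 2)) t' 0).minEnergyOn
        (szSector (2 * n) 0) ≤
      (hamiltonian (fermionTorusGraph 2 L) (1 + t') (2 * U)).minEnergyOn (szSector (2 * n) 0) := by
  intro L _ hL h4 t' U n hn
  have hn' : n ≤ Fintype.card (FermionTorus 2 L) := by
    rwa [Summit.HubbardSuperconductivity.NoGo.card_fermionTorus_two]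
  exact two_mul_sectorEnergy_le_partner hL h4 t' U hn'

end Summit.HubbardSuperconductivity.PbContinuation

end
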